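import Summits.Ventures.HodgeKum4.Theorems.KummerFixedLocusTransitiveTangent
import HarnessLib

/-!
# Route A ON `X`: the fixed-locus chain from a LOCAL split hypothesis (cell `hodge-kum4`, seat p2 g5)
# — §1 `Γ(X)` basics, §2 split fixed-point schemes, §3 transitivity of `Γ(X)` on `Fix(g)`

HONEST FRAMING.  Nothing here is proved outright about varieties of `Kum⁴`-type or the Hodge
conjecture.  The theorems are the X-LOCAL forms of the cell's Route-A theorems
(`Theorems/KummerFixedLocusTransitiveTangent`, `…HasFixedPointTangent`, `…PointCountAssembly`,
`…KummerPointAssembly`), which were stated AT the generalized Kummer varieties `K⁴(A)` because their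
one geometric input — "the fixed-point scheme of `⟨g⟩`, `g ∈ Γ ∖ 1`, is `125` reduced points"
(Oguiso 2020 Prop. 3.5–3.6, `Hyperkaehler.Oguiso2020_fixedPointScheme_translation_generalizedKummerFour`)
— is printed there.  Here that input is a HYPOTHESIS `hsplit` about the given smooth projective `X` of
`Kum⁴`-type (for every `g ∈ Γ(X) ∖ 1` and every fixed-point scheme `j : F ⟶ X` of `⟨g⟩`, a splitting
`F ≅ ⊔_{125} Spec ℂ`), and everything else is VERBATIM the Route-A argument: the proofs below are the
landed proofs with the Kummer-point binders `(A, K, A.dim = 2, IsGeneralizedKummerVarietyOf 4 A K)`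
replaced by `(X, IsOfGeneralizedKummerType 4 X)` and Oguiso's fact by `hsplit`.  Printed inputs, BY
NAME: `Γ ≅ (ℤ/5)⁴` (`FloccariVaresco2024_autFixingH2H3_equiv_kumType`, REFEREED) and the
tangent-dimension fact (`GroupActions.Milne2017_fixedComponent_dim_eq_finrank_tangentFixed`, REFEREED
textbook).  PURPOSE (module `KummerFixedLocusMeetsTranslatesLocal`): the WHOLE fixed-locus branch of
rung H3 on an arbitrary `X` — I1geo `Kum4FixedFourfoldMeetsTranslates`, hence crux I, L3° and
`HC_Kum4Type` — follows from print + L1 + the single fibrewise statement `hsplit` on `X`, with NO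
cohomological transport (T), NO Kummer-point input and NO (H2); at `X = K⁴(A)` the hypothesis is
Oguiso's printed statement and the theorems specialise to the landed ones.

* §1 `gamma_comm_card_pow_five` — `Γ(X)` is commutative, of order `625`, of exponent `5` (from FV).
* §2 `fixedPoints_eq_iUnion_of_split`, `disjoint_range_of_split` — for a split fixed-point scheme
  `F = ⊔ₖ xₖ` of `⟨g⟩`, the `g`-fixed complex points of `X` are the disjoint union of the points `xₖ`.
* §3 `transitive_of_split` — (H2) ON `X`: `Γ(X)` is transitive on the `g`-fixed sections
  (stabiliser `= ⟨g⟩` by `RankTwo.eq_zero_of_free` + tangent-dimension fact; orbit–stabiliser).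
-/

noncomputable section

open CategoryTheory CategoryTheory.Limits MonoidalCategory CartesianMonoidalCategory
open AlgebraicGeometry
open Literature.AlgebraicGeometry Literature.AlgebraicGeometry.Motives
open Literature.AlgebraicGeometry.Hyperkaehler Literature.AlgebraicGeometry.GroupActions

namespace Summit.Ventures.HodgeKum4

namespace FixedPointsLocal

/-! ### §1 `Γ(X)` for `X` of `Kum⁴`-type: commutative, order `625`, exponent `5` -/

/-- From `Γ(X) ≅ (ℤ/5)⁴` (Floccari–Varesco, hypothesis): `Γ(X)` is commutative, has `625` elements,
and every element satisfies `γ⁵ = 1`. -/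
theorem gamma_comm_card_pow_five (hFV : FloccariVaresco2024_autFixingH2H3_equiv_kumType)
    {X : Motives.SchemeOver ℂ} (hX8 : Motives.IsSmoothProjective 8 X)
    (hKX : IsOfGeneralizedKummerType 4 X) :
    (∀ p q : autFixingH2H3 X, p * q = q * p) ∧ Nat.card (autFixingH2H3 X) = 625 ∧
      ∀ γ : autFixingH2H3 X, γ ^ 5 = 1 := by
  obtain ⟨e⟩ := hFV 4 (by norm_num) hX8 hKX
  refine ⟨fun p q => e.injective ((e.map_mul p q).trans ((mul_comm _ _).trans (e.map_mul q p).symm)),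
    FloccariVaresco2024_autFixingH2H3_equiv_kumType.floccari2026_card hFV hX8 hKX, fun γ => ?_⟩
  apply e.injective
  have hz : ∀ z : Multiplicative (Fin 4 → ZMod (4 + 1)), z ^ 5 = 1 := by
    intro z
    apply Multiplicative.toAdd.injective
    rw [toAdd_pow, toAdd_one]
    funext i
    simp only [Pi.smul_apply, Pi.zero_apply, nsmul_eq_mul]
    have h5 : ((5 : ℕ) : ZMod (4 + 1)) = 0 := by decide
    rw [h5, zero_mul]
  calc e (γ ^ 5) = e γ ^ 5 := map_pow e γ 5
    _ = 1 := hz _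
    _ = e 1 := (map_one e).symm

/-! ### §2 Split fixed-point schemes: the fixed complex points are the split points -/

/-- If the fixed-point scheme `j : F ⟶ X` of `⟨g⟩` is the coproduct of sections `x k : Spec ℂ ⟶ F`,
the `g`-fixed complex points of `X` are exactly the complex points of the `x k ≫ j`. -/
theorem fixedPoints_eq_iUnion_of_split {X F : Motives.SchemeOver ℂ} (g : Aut X) (j : F ⟶ X)
    (hj : IsFixedPointScheme (Subgroup.zpowers g).subtype j) {n : ℕ}
    (x : Fin n → (𝟙_ (Motives.SchemeOver ℂ) ⟶ F)) (hx : IsColimit (Cofan.mk F x)) :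
    {Q : Motives.ComplexPoints X | Motives.AlgPoints.mapContinuous (L := ℂ) g.hom Q = Q} =
      ⋃ k, Set.range (Motives.AlgPoints.mapContinuous (L := ℂ) (x k ≫ j)) := by
  have hjg : j ≫ g.hom = j := hj.comp_hom ⟨g, Subgroup.mem_zpowers g⟩
  ext Q
  simp only [Set.mem_setOf_eq, Motives.AlgPoints.mapContinuous_apply, Motives.AlgPoints.map_apply,
    Set.mem_iUnion, range_mapContinuous_of_unit, Set.mem_singleton_iff]
  constructor
  · intro hQ
    -- `Q` is `⟨g⟩`-fixed, hence factors through `j`, hence through one of the sections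
    have hQ' : ∀ a : Subgroup.zpowers g,
        (Motives.toSpecOver (𝟙_ (Motives.SchemeOver ℂ)) ≫ Q) ≫ ((Subgroup.zpowers g).subtype a).hom =
          Motives.toSpecOver (𝟙_ (Motives.SchemeOver ℂ)) ≫ Q := fun a => by
      show (Motives.toSpecOver (𝟙_ (Motives.SchemeOver ℂ)) ≫ Q) ≫ a.val.hom =
        Motives.toSpecOver (𝟙_ (Motives.SchemeOver ℂ)) ≫ Q
      rw [Category.assoc, comp_hom_eq_of_mem_zpowers g Q hQ a.val a.property]
    obtain ⟨t, ht, -⟩ := hj.existsUnique_fac (Motives.toSpecOver (𝟙_ (Motives.SchemeOver ℂ)) ≫ Q) hQ'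
    obtain ⟨k, rfl⟩ := SplitPoints.exists_eq x hx t
    refine ⟨k, ?_⟩
    rw [← toUnit_comp_toSpecOver_comp Q, ← ht]
  · rintro ⟨k, rfl⟩
    show (toUnit (Motives.specOver ℂ ℂ) ≫ x k ≫ j) ≫ g.hom = toUnit (Motives.specOver ℂ ℂ) ≫ x k ≫ j
    rw [Category.assoc, Category.assoc, hjg]

/-- The complex points of distinct sections of a split fixed-point scheme are distinct. -/
theorem disjoint_range_of_split {X F : Motives.SchemeOver ℂ} (g : Aut X) (j : F ⟶ X)
    (hj : IsFixedPointScheme (Subgroup.zpowers g).subtype j) {n : ℕ}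
    (x : Fin n → (𝟙_ (Motives.SchemeOver ℂ) ⟶ F)) (hx : IsColimit (Cofan.mk F x)) :
    ∀ k k' : Fin n, k ≠ k' →
      Disjoint (Set.range (Motives.AlgPoints.mapContinuous (L := ℂ) (x k ≫ j)))
        (Set.range (Motives.AlgPoints.mapContinuous (L := ℂ) (x k' ≫ j))) := by
  haveI : Mono j := hj.toIsFixedPointObject.mono
  intro k k' hkk'
  rw [range_mapContinuous_of_unit, range_mapContinuous_of_unit, Set.disjoint_singleton]
  intro h
  apply hkk'
  have h1 : x k ≫ j = x k' ≫ j := toUnit_comp_injective h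
  exact SplitPoints.injective x hx ((cancel_mono j).1 h1)

/-- **No fixed tangent vector at an isolated fixed point.**  If `φ ∈ Stab(P)` has finite order, the
fixed-point scheme `j : F ⟶ X` of `⟨φ⟩` splits into finitely many sections and `X` is smooth projective
(so the tangent-dimension fact applies to the partition of `Fix(φ)(ℂ)` into POINTS), then the tangent
action `τ φ` of the tangent-dimension fact has no non-zero fixed vector.  Here `τ`, `hτ` are the data
produced by `GroupActions.Milne2017_fixedComponent_dim_eq_finrank_tangentFixed` at `P`. -/
theorem tangentFixed_eq_zero_of_split {X F : Motives.SchemeOver ℂ} [IsSeparated X.hom] {n : ℕ}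
    {P : Motives.ComplexPoints X} {V : Type} [AddCommGroup V] [Module ℂ V] [FiniteDimensional ℂ V]
    (τ : Representation ℂ (GroupActions.pointStabilizer X P) V)
    (hτ : ∀ φ : GroupActions.pointStabilizer X P, IsOfFinOrder φ →
      ∀ (J : Type) (_ : Fintype J) (Z : J → Motives.SchemeOver ℂ) (d : J → ℕ) (c : ∀ j, Z j ⟶ X),
        (∀ j, Motives.IsSmoothProjective (d j) (Z j)) →
        (∀ j, IsClosedImmersion (c j).left) →
        (∀ j j', j ≠ j' →
          Disjoint (Set.range (Motives.AlgPoints.mapContinuous (L := ℂ) (c j)))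
            (Set.range (Motives.AlgPoints.mapContinuous (L := ℂ) (c j')))) →
        {x : Motives.ComplexPoints X | Motives.AlgPoints.mapContinuous (L := ℂ) φ.val.hom x = x} =
          ⋃ j, Set.range (Motives.AlgPoints.mapContinuous (L := ℂ) (c j)) →
        ∀ j, P ∈ Set.range (Motives.AlgPoints.mapContinuous (L := ℂ) (c j)) →
          d j = Module.finrank ℂ (LinearMap.ker (τ φ - 1)))
    (φ : GroupActions.pointStabilizer X P) (hφ : IsOfFinOrder φ) (j : F ⟶ X)
    (hj : IsFixedPointScheme (Subgroup.zpowers φ.val).subtype j)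
    (x : Fin n → (𝟙_ (Motives.SchemeOver ℂ) ⟶ F)) (hx : IsColimit (Cofan.mk F x)) :
    ∀ v : V, τ φ v = v → v = 0 := by
  intro v hv
  have hfix := fixedPoints_eq_iUnion_of_split φ.val j hj x hx
  obtain ⟨k₀, hk₀⟩ : ∃ k, P ∈ Set.range (Motives.AlgPoints.mapContinuous (L := ℂ) (x k ≫ j)) := by
    have : P ∈ {Q : Motives.ComplexPoints X |
        Motives.AlgPoints.mapContinuous (L := ℂ) φ.val.hom Q = Q} := by
      rw [Set.mem_setOf_eq, Motives.AlgPoints.mapContinuous_apply]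
      exact GroupActions.mem_pointStabilizer_iff.1 φ.property
    rw [hfix, Set.mem_iUnion] at this
    exact this
  have h0 : 0 = Module.finrank ℂ (LinearMap.ker (τ φ - 1)) :=
    hτ φ hφ (Fin n) inferInstance (fun _ => 𝟙_ (Motives.SchemeOver ℂ)) (fun _ => 0)
      (fun k => x k ≫ j) (fun _ => Motives.isSmoothProjective_unit_holds ℂ)
      (fun k => isClosedImmersion_left_of_unit (x k ≫ j)) (disjoint_range_of_split φ.val j hj x hx)
      hfix k₀ hk₀
  have hbot : LinearMap.ker (τ φ - 1) = ⊥ := Submodule.finrank_eq_zero.1 h0.symm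
  have hv' : v ∈ LinearMap.ker (τ φ - 1) := by
    rw [LinearMap.mem_ker, LinearMap.sub_apply, Module.End.one_apply, hv, sub_self]
  rw [hbot] at hv'
  exact (Submodule.mem_bot ℂ).1 hv'

/-! ### §3 (H2) on `X`: `Γ(X)` is transitive on the `g`-fixed sections -/

/-- **Transitivity of `Γ(X)` on `Fix(g)` from a split hypothesis** (X-local form of
`oguiso2020_translations_transitive_of_tangentFixed`).  For `X` smooth projective of `Kum⁴`-type,
suppose that for every `δ ∈ Γ(X) ∖ 1` every fixed-point scheme of `⟨δ⟩` splits into `125` sections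
(`hsplit`).  Then for `g ∈ Γ(X) ∖ 1` any two `g`-fixed sections `x, y : Spec ℂ ⟶ X` are `Γ(X)`-translates.
Printed inputs BY NAME: `Γ ≅ (ℤ/5)⁴` (FV), the tangent-dimension fact.  Proof: the stabiliser of `x` is
`⟨g⟩` (else `(ℤ/5)²` would act freely and linearly on `T_x X ≅ ℂ⁸`, `RankTwo.eq_zero_of_free`), and
orbit–stabiliser.  CONDITIONAL; nothing is proved outright. -/
theorem transitive_of_split (hFV : FloccariVaresco2024_autFixingH2H3_equiv_kumType)
    (hT : GroupActions.Milne2017_fixedComponent_dim_eq_finrank_tangentFixed)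
    {X : Motives.SchemeOver ℂ} (hX8 : Motives.IsSmoothProjective 8 X) (hKX : IsOfGeneralizedKummerType 4 X)
    (hsplit : ∀ δ : autFixingH2H3 X, δ ≠ 1 → ∀ ⦃F : Motives.SchemeOver ℂ⦄ (j : F ⟶ X),
      IsFixedPointScheme (Subgroup.zpowers δ.val).subtype j →
      ∃ x : Fin 125 → (𝟙_ (Motives.SchemeOver ℂ) ⟶ F), Nonempty (IsColimit (Cofan.mk F x)))
    (g : autFixingH2H3 X) (hg : g ≠ 1) (x y : 𝟙_ (Motives.SchemeOver ℂ) ⟶ X)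
    (hx : x ≫ g.val.hom = x) (hy : y ≫ g.val.hom = y) :
    ∃ γ : autFixingH2H3 X, x ≫ γ.val.hom = y := by
  classical
  haveI : IsProper X.hom := hX8.isProjectiveOver.isProper
  obtain ⟨hcomm, hcard, hpow5⟩ := gamma_comm_card_pow_five hFV hX8 hKX
  haveI : Fact (Nat.Prime 5) := ⟨by norm_num⟩
  have horder : orderOf g = 5 := orderOf_eq_prime (hpow5 g) hg
  haveI : Finite (autFixingH2H3 X) := Nat.finite_of_card_ne_zero (by rw [hcard]; norm_num)
  have hfin : ∀ δ : autFixingH2H3 X, Finite (Subgroup.zpowers δ.val) := fun δ => by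
    have hle : Subgroup.zpowers δ.val ≤ autFixingH2H3 X := (Subgroup.zpowers_le).2 δ.2
    exact Set.Finite.subset (Set.toFinite (autFixingH2H3 X : Set (Aut X))) hle
  -- the finite `Γ`-set `S` of `g`-fixed sections
  let S := {s : 𝟙_ (Motives.SchemeOver ℂ) ⟶ X // s ≫ g.val.hom = s}
  have hact_mem : ∀ (γ : autFixingH2H3 X) (s : S), (s.val ≫ γ.val.hom) ≫ g.val.hom = s.val ≫ γ.val.hom := by
    intro γ s
    have hγg : γ.val.hom ≫ g.val.hom = g.val.hom ≫ γ.val.hom := by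
      have := congrArg (fun δ : autFixingH2H3 X => δ.val.hom) (hcomm g γ)
      simpa [Subgroup.coe_mul, Aut.Aut_mul_def] using this
    rw [Category.assoc, hγg, ← Category.assoc, s.property]
  letI : SMul (autFixingH2H3 X) S := ⟨fun γ s => ⟨s.val ≫ γ.val.hom, hact_mem γ s⟩⟩
  letI : MulAction (autFixingH2H3 X) S :=
    { one_smul := fun s => Subtype.ext (Category.comp_id s.val)
      mul_smul := fun p q s => Subtype.ext
        ((Category.assoc s.val q.val.hom p.val.hom).symm :
          s.val ≫ (p * q).val.hom = (s.val ≫ q.val.hom) ≫ p.val.hom) }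
  have hsmul : ∀ (γ : autFixingH2H3 X) (s : S), (γ • s).val = s.val ≫ γ.val.hom := fun _ _ => rfl
  -- `|S| = 125` (the split fixed-point scheme of `⟨g⟩`)
  haveI := hfin g
  obtain ⟨F, j, hj⟩ := exists_isFixedPointScheme (Subgroup.zpowers g.val).subtype
  obtain ⟨xs, ⟨hxs⟩⟩ := hsplit g hg j hj
  have hjg : j ≫ g.val.hom = j := hj.comp_hom ⟨g.val, Subgroup.mem_zpowers g.val⟩
  haveI : Mono j := hj.toIsFixedPointObject.mono
  let enum : Fin 125 → S := fun k => ⟨xs k ≫ j, by rw [Category.assoc, hjg]⟩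
  have henum : Function.Bijective enum := by
    constructor
    · intro k k' hkk'
      have h1 : xs k ≫ j = xs k' ≫ j := congrArg Subtype.val hkk'
      exact SplitPoints.injective xs hxs ((cancel_mono j).1 h1)
    · intro s
      have hs' : ∀ a : Subgroup.zpowers g.val, s.val ≫ ((Subgroup.zpowers g.val).subtype a).hom = s.val :=
        fun a => comp_hom_eq_of_mem_zpowers g.val s.val s.property a.val a.property
      obtain ⟨t, ht, -⟩ := hj.existsUnique_fac s.val hs'
      obtain ⟨k, rfl⟩ := SplitPoints.exists_eq xs hxs t
      exact ⟨k, Subtype.ext ht⟩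
  have hcardS : Nat.card S = 125 := by
    rw [← Nat.card_congr (Equiv.ofBijective enum henum), Nat.card_fin]
  haveI : Finite S := Finite.of_equiv _ (Equiv.ofBijective enum henum)
  let x' : S := ⟨x, hx⟩
  let y' : S := ⟨y, hy⟩
  -- CLAIM: the stabiliser of `x'` is `⟨g⟩`
  have hstab : MulAction.stabilizer (autFixingH2H3 X) x' = Subgroup.zpowers g := by
    apply le_antisymm
    · intro γ hγ
      rw [MulAction.mem_stabilizer_iff] at hγ
      have hγx : x ≫ γ.val.hom = x := congrArg Subtype.val hγ
      by_contra hγg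
      -- the complex point `P = x`, the tangent representation of its stabiliser
      let P : Motives.ComplexPoints X := toUnit (Motives.specOver ℂ ℂ) ≫ x
      have hmemP : ∀ δ : autFixingH2H3 X, x ≫ δ.val.hom = x → δ.val ∈ GroupActions.pointStabilizer X P := by
        intro δ hδ
        rw [GroupActions.mem_pointStabilizer_iff, Motives.AlgPoints.map_apply]
        show (toUnit (Motives.specOver ℂ ℂ) ≫ x) ≫ δ.val.hom = toUnit (Motives.specOver ℂ ℂ) ≫ x
        rw [Category.assoc, hδ]
      obtain ⟨V, _, _, _, τ, hVn, hτ⟩ := hT hX8 P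
      -- every `δ ∈ Γ ∖ 1` fixing `x` has no non-zero fixed tangent vector (its fixed points are split)
      have hfix0 : ∀ (δ : autFixingH2H3 X) (hδ1 : δ ≠ 1) (hδx : x ≫ δ.val.hom = x) (v : V),
          τ ⟨δ.val, hmemP δ hδx⟩ v = v → v = 0 := by
        intro δ hδ1 hδx
        let φ : GroupActions.pointStabilizer X P := ⟨δ.val, hmemP δ hδx⟩
        have hφ5 : φ ^ 5 = 1 := by
          apply Subtype.ext
          rw [Subgroup.coe_pow, Subgroup.coe_one]
          show δ.val ^ 5 = 1
          rw [← Subgroup.coe_pow, hpow5 δ, Subgroup.coe_one]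
        have hφfin : IsOfFinOrder φ := isOfFinOrder_iff_pow_eq_one.2 ⟨5, by norm_num, hφ5⟩
        haveI := hfin δ
        obtain ⟨Fδ, jδ, hjδ⟩ := exists_isFixedPointScheme (Subgroup.zpowers δ.val).subtype
        obtain ⟨xδ, ⟨hxδ⟩⟩ := hsplit δ hδ1 jδ hjδ
        exact tangentFixed_eq_zero_of_split τ hτ φ hφfin jδ hjδ xδ hxδ
      -- the two commuting operators `a = dg`, `b = dγ` on `T_x X`
      let g' : GroupActions.pointStabilizer X P := ⟨g.val, hmemP g hx⟩
      let γ' : GroupActions.pointStabilizer X P := ⟨γ.val, hmemP γ hγx⟩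
      have hval5 : ∀ δ : autFixingH2H3 X, δ.val ^ 5 = 1 := fun δ => by
        rw [← Subgroup.coe_pow, hpow5 δ, Subgroup.coe_one]
      have hg'5 : g' ^ 5 = 1 := Subtype.ext (by rw [Subgroup.coe_pow, Subgroup.coe_one]; exact hval5 g)
      have hγ'5 : γ' ^ 5 = 1 := Subtype.ext (by rw [Subgroup.coe_pow, Subgroup.coe_one]; exact hval5 γ)
      have hg'γ' : g' * γ' = γ' * g' := by
        apply Subtype.ext
        rw [Subgroup.coe_mul, Subgroup.coe_mul]
        show g.val * γ.val = γ.val * g.val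
        rw [← Subgroup.coe_mul, ← Subgroup.coe_mul, hcomm g γ]
      have hcommτ : Commute (τ g') (τ γ') := by
        show τ g' * τ γ' = τ γ' * τ g'
        rw [← map_mul, ← map_mul, hg'γ']
      have ha5 : τ g' ^ 5 = 1 := by rw [← map_pow, hg'5, map_one]
      have hb5 : τ γ' ^ 5 = 1 := by rw [← map_pow, hγ'5, map_one]
      -- every `gⁱ γʲ ≠ 1` fixes `x` and is fixed-point free on `T_x X`
      have hg_stab : g ∈ MulAction.stabilizer (autFixingH2H3 X) x' :=
        MulAction.mem_stabilizer_iff.2 (Subtype.ext hx)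
      have hγ_stab : γ ∈ MulAction.stabilizer (autFixingH2H3 X) x' := MulAction.mem_stabilizer_iff.2 hγ
      have hfree : ∀ i j : ℕ, i < 5 → j < 5 → ¬ (i = 0 ∧ j = 0) →
          ∀ v, (τ g' ^ i * τ γ' ^ j) v = v → v = 0 := by
        intro i j hi hj hij v hv
        have hδx : x ≫ (g ^ i * γ ^ j).val.hom = x := by
          have hmem : g ^ i * γ ^ j ∈ MulAction.stabilizer (autFixingH2H3 X) x' :=
            Subgroup.mul_mem _ (Subgroup.pow_mem _ hg_stab i) (Subgroup.pow_mem _ hγ_stab j)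
          exact congrArg Subtype.val (MulAction.mem_stabilizer_iff.1 hmem)
        have hδ1 : g ^ i * γ ^ j ≠ 1 := by
          intro hδ
          have hγj : γ ^ j ∈ Subgroup.zpowers g := by
            rw [eq_inv_of_mul_eq_one_right hδ]
            exact Subgroup.inv_mem _ (Subgroup.pow_mem _ (Subgroup.mem_zpowers g) i)
          rcases Nat.eq_zero_or_pos j with hj0 | hj0
          · subst hj0
            have hi0 : i ≠ 0 := fun h => hij ⟨h, rfl⟩
            have hgi : g ^ i = 1 := by simpa using hδ
            have hdvd : orderOf g ∣ i := orderOf_dvd_of_pow_eq_one hgi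
            rw [horder] at hdvd
            exact absurd (Nat.le_of_dvd (Nat.pos_of_ne_zero hi0) hdvd) (by omega)
          · exact hγg (mem_of_pow_mem_of_pow_five (Subgroup.zpowers g) (hpow5 γ) hj0 hj hγj)
        have hδ' : (⟨(g ^ i * γ ^ j).val, hmemP _ hδx⟩ : GroupActions.pointStabilizer X P) =
            g' ^ i * γ' ^ j := by
          apply Subtype.ext
          show (g ^ i * γ ^ j).val = ((g' ^ i * γ' ^ j : GroupActions.pointStabilizer X P) : Aut X)
          rw [Subgroup.coe_mul, Subgroup.coe_pow, Subgroup.coe_pow, Subgroup.coe_mul, Subgroup.coe_pow,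
            Subgroup.coe_pow]
        have hτδ : τ ⟨(g ^ i * γ ^ j).val, hmemP _ hδx⟩ = τ g' ^ i * τ γ' ^ j := by
          rw [hδ', map_mul, map_pow, map_pow]
        exact hfix0 (g ^ i * γ ^ j) hδ1 hδx v (by rw [hτδ]; exact hv)
      -- contradiction: `T_x X = 0` but `dim T_x X = 8`
      have hV0 : ∀ v : V, v = 0 :=
        RankTwo.eq_zero_of_free (F := ℂ) (by norm_num) (τ g') (τ γ') hcommτ ha5 hb5 hfree
      haveI : Subsingleton V := ⟨fun a b => by rw [hV0 a, hV0 b]⟩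
      have : Module.finrank ℂ V = 0 := Module.finrank_zero_of_subsingleton
      omega
    · exact (Subgroup.zpowers_le).2 (MulAction.mem_stabilizer_iff.2 (Subtype.ext hx))
  -- orbit–stabiliser: `|Γ · x'| = 625 / 5 = 125 = |S|`, so the orbit is everything
  have hindex : (MulAction.stabilizer (autFixingH2H3 X) x').index = 125 := by
    have h := (MulAction.stabilizer (autFixingH2H3 X) x').index_mul_card
    rw [hstab, Nat.card_zpowers, horder, hcard] at h
    rw [hstab]
    omega
  have horbit : (MulAction.orbit (autFixingH2H3 X) x').ncard = 125 := by
    rw [← MulAction.index_stabilizer, hindex]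
  have huniv : MulAction.orbit (autFixingH2H3 X) x' = Set.univ :=
    Set.eq_of_subset_of_ncard_le (Set.subset_univ _) (by rw [Set.ncard_univ, hcardS, horbit])
      Set.finite_univ
  have hy' : y' ∈ MulAction.orbit (autFixingH2H3 X) x' := by rw [huniv]; exact Set.mem_univ _
  obtain ⟨γ, hγ⟩ := MulAction.mem_orbit_iff.1 hy'
  exact ⟨γ, by rw [← hsmul γ x', hγ]⟩

end FixedPointsLocal

end Summit.Ventures.HodgeKum4

end
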